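import Summits.CriticalPhenomena.PercolationContinuityZ3.Theorems.Transplant.SiteKNSteps
import HarnessLib

/-!
# SITE Kozma–Nitzan §4 — Step III for the site scheme: the site target lemma turns "`F^{j+1}` reached" into
# "good at level `j`"

builds on p205010 (kernel theorem, internal audit signed; external expert review pending).
Lane `prim-bschramm`, class C1a (site percolation on `ℤ³`); block (γ) of the SITE same-`p` witness
(`SiteSameP.SiteSamePWitnessZd`, socket p217536), prim-hp-8 lineage.  Site twin of `KSch.cond_of_face` of
`L/KozmaNitzanSteps.lean` and of its static inclusions.  Helper file (`--supports stmt-CriticalPhenomena-4575`).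

* `regionH_subset_Sx`, `Rj_subset_Sx` — `E_i ∪ E_{w,v} ∪ H^j_{v,x} ⊆ E_i ∪ E_{w,v} ∪ E_{v,x}`;
* `cond_of_face` — Step III (KN p. 30): if `F^{j+1}_{v,x}` is reached from `0` with probability `> 1 − δ₂` under the
  weighting of level `j`, then the connection is good at level `j`, by the site target lemma (fed as a hypothesis, with
  the elongated geometries of aspect `2K`; the target `KSch.isTarget_stepIII` and the subbox `KSch.Dpast` are the bond
  ones verbatim).
[cite: KozmaNitzan2024, §4 p. 30 (Step III)]
-/

noncomputable section

namespace Summit.CriticalPhenomena.PercolationContinuityZ3.Theorems.Transplant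

namespace SiteKN

open MeasureTheory ProbabilityTheory
open Literature.Probability.Percolation Literature.Probability.LatticeModels
open Literature.Probability.Percolation.KozmaNitzan Literature.Probability.Percolation.KozmaNitzan.Cells
open GadgetSystem ProbeHistory Contour
open SiteTransplant (siteConn mem_siteConn)
open scoped Classical

variable {d : ℕ}

namespace SKSch

variable {S : SKSch d}

/-! ## Static inclusions -/

/-- `E_i ∪ E_{w,v} ∪ H_{v,x} ⊆ E_i ∪ E_{w,v} ∪ E_{v,x}`. [folklore] -/
theorem regionH_subset_Sx (S : SKSch d) (h : ProbeHistory (Option (Site d))) (e : Site 2 × MDir) (du : MDir) :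
    ∀ y ∈ S.V h ∪ S.C.Ewv e.1 e.2 ∪ S.C.Hfull (tgt e) du, y ∈ S.Sx h e du := by
  intro y hy
  rcases Finset.mem_union.1 hy with hy | hy
  · exact Finset.mem_union_left _ hy
  · rcases S.C.mem_Q_or_Efar_of_mem_Hfull hy with hy | hy
    · exact Finset.mem_union_left _ (Finset.mem_union_right _ (Finset.mem_union_right _ hy))
    · exact Finset.mem_union_right _ hy

/-- `E_i ∪ E_{w,v} ∪ H^j_{v,x} ⊆ E_i ∪ E_{w,v} ∪ E_{v,x}` for `j ≤ K`. [folklore] -/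
theorem Rj_subset_Sx (S : SKSch d) (h : ProbeHistory (Option (Site d))) (e : Site 2 × MDir) (du : MDir) {j : ℕ}
    (hj : j ≤ S.C.K) : S.Rj h e du j ⊆ S.Sx h e du :=
  (Finset.union_subset_union le_rfl (S.C.Stub_subset_Hfull _ _ hj)).trans fun y hy => regionH_subset_Sx S h e du y hy

section Setting

variable {h : ProbeHistory (Option (Site d))} {e : Site 2 × MDir} (hV : S.Valid h e) {du : MDir}
  (hdu : du ∈ S.onward h (tgt e))
include hV hdu

/-! ## Step III: the site target lemma turns "`F^{j+1}` reached" into "good at level `j`" -/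

/-- **Step III** (KN p. 30): if `F^{j+1}_{v,x}` is reached from `0` with probability `> 1 − δ₂` under the weighting of
level `j`, then the connection is good at level `j` — by the site target lemma, here the hypothesis `htgt` (with
`δ_{L10} = δ₂`, its `R`, and the elongated geometries of aspect `2K`). [cite: KozmaNitzan2024, §4 p. 30 (Step III)] -/
theorem cond_of_face {δ₂ : ℝ} {R : ℕ}
    (htgt : ∀ (w : Site d → unitInterval) (Sfin D : Finset (Site d)) (lo hi : Site d)
      (T : Finset (Site d)) (o : Site d),
      SiteFinSupp w Sfin → SiteIsSubbox w S.p D → D ⊆ Sfin → o ∈ Sfin → o ∉ D →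
      Finset.Icc (lo - (R : Site d)) (hi + (R : Site d)) ⊆ D →
      IsTarget T lo hi D R (elongList d (2 * S.C.K) (by have := S.C.hK; omega)) → T ⊆ D → T.Nonempty →
      1 - δ₂ < (prodBernoulli w).real (⋃ b ∈ Finset.Icc lo hi, siteConn (zdGraph d) o b) →
      1 - S.δc < (prodBernoulli w).real (⋃ t ∈ T, siteConn (zdGraph d) o t))
    (hRs : 2 * R ≤ S.C.s) {j : ℕ} (hj : j < S.C.K) (o : Finset (Site d))
    (hface : 1 - δ₂ < (prodBernoulli (S.Wt h e du j o)).real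
      (⋃ b ∈ S.C.Face (tgt e) du (j + 1), siteConn (zdGraph d) (0 : Site d) b)) :
    1 - S.δc < (prodBernoulli (S.Wt h e du j o)).real (S.Conn e du) := by
  set D := KSch.Dpast S.toKSch e du j with hD
  have hK : (20 : ℤ) ≤ S.C.K := by exact_mod_cast S.C.hK
  have hs1 : (1 : ℤ) ≤ S.C.s := by exact_mod_cast S.C.hs
  have hr1 : (1 : ℤ) ≤ S.C.r := by exact_mod_cast S.C.r_pos
  have hrK : (S.C.r : ℤ) = S.C.K * S.C.s := by unfold Cells.r; push_cast; ring
  have hRs' : 2 * (R : ℤ) ≤ S.C.s := by exact_mod_cast hRs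
  have hjK : (j : ℤ) + 1 ≤ S.C.K := by exact_mod_cast hj
  have hjs : 10 * (S.C.s : ℤ) * (j + 1) ≤ 10 * S.C.s * S.C.K := mul_le_mul_of_nonneg_left hjK (by positivity)
  have hKs20 : 20 * (S.C.s : ℤ) ≤ S.C.K * S.C.s := mul_le_mul_of_nonneg_right hK (by linarith)
  have hj0 : (0 : ℤ) ≤ 10 * S.C.s * j := by positivity
  have hDE : D ⊆ S.C.Efar (tgt e) du := KSch.Dpast_subset_Efar (S := S.toKSch) (e := e) (du := du) j
  have hDS : D ⊆ S.Sx h e du := hDE.trans Finset.subset_union_right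
  -- the subbox
  have hsub : SiteIsSubbox (S.Wt h e du j o) S.p D := by
    refine ((siteIsSubbox_const S.p D).pinW (fun y hyD hyR => ?_) _).siteRestrW (Finset.coe_subset.2 hDS)
    have hyR' : y ∈ S.Rj h e du j := Finset.mem_coe.1 hyR
    rcases Finset.mem_union.1 hyR' with hy' | hy'
    · rcases Finset.mem_union.1 hy' with hy'' | hy''
      · exact (Valid.sep_Efar hV hdu).not_mem (Finset.mem_coe.2 hy'') (Finset.mem_coe.2 (hDE hyD))
      · exact Valid.not_mem_Ewv_of_mem_Efar hV hdu (hDE hyD) hy''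
    · rw [Cells.Stub, mem_sBox_iff (sgOf_sign du)] at hy'
      rw [hD, KSch.Dpast, mem_sBox_iff (sgOf_sign du)] at hyD
      linarith [hy'.1.2, hyD.1.1]
  have h0S : (0 : Site d) ∈ S.Sx h e du := Finset.mem_union_left _ (Finset.mem_union_left _ hV.zero_mem)
  have h0D : (0 : Site d) ∉ D := fun h0 =>
    (Valid.sep_Efar hV hdu).not_mem (Finset.mem_coe.2 hV.zero_mem) (Finset.mem_coe.2 (hDE h0))
  -- the enlarged face lies in `D`
  have hencl : Finset.Icc (sLo (S.C.axOf du) (sgOf du) (S.C.cen (tgt e)) (5 * S.C.r + 10 * S.C.s * (j + 1 : ℕ))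
        (5 * S.C.r + 10 * S.C.s * (j + 1 : ℕ)) (2 * S.C.r) - (R : Site d))
      (sHi (S.C.axOf du) (sgOf du) (S.C.cen (tgt e)) (5 * S.C.r + 10 * S.C.s * (j + 1 : ℕ))
        (5 * S.C.r + 10 * S.C.s * (j + 1 : ℕ)) (2 * S.C.r) + (R : Site d)) ⊆ D := by
    rw [sBox_enlarge _ _ (sgOf_sign du)]
    refine sBox_mono (sgOf_sign du) _ ?_ ?_ ?_
    · push_cast; linarith
    · push_cast; nlinarith
    · linarith
  -- `M_x ⊆ D`
  have hMD : S.C.M (tgt e + stepVec du) ⊆ D := by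
    intro y hy
    obtain ⟨hl, ht⟩ := S.C.level_of_mem_M_tgt hy
    rw [hD, KSch.Dpast, mem_sBox_iff (sgOf_sign du)]
    refine ⟨⟨by nlinarith [hl.1], by linarith [hl.2]⟩, fun i hi => ?_⟩
    have := ht i hi; constructor <;> linarith [this.1, this.2]
  have hMne : (S.C.M (tgt e + stepVec du)).Nonempty := ⟨_, center_mem_cIcc _ _⟩
  exact htgt (S.Wt h e du j o) (S.Sx h e du) D _ _ (S.C.M (tgt e + stepVec du)) 0 (siteFinSupp_siteRestrW _ _) hsub
    hDS h0S h0D hencl (KSch.isTarget_stepIII (S := S.toKSch) (e := e) (du := du) hRs hj) hMD hMne hface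

end Setting

end SKSch

end SiteKN

end Summit.CriticalPhenomena.PercolationContinuityZ3.Theorems.Transplant

end
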